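import Literature.NumberTheory.Automorphic.AdelicPoissonSummation
import Literature.NumberTheory.Automorphic.IdeleModuleProofs
import Literature.NumberTheory.Automorphic.IwasawaHaarGL2
import HarnessLib

/-!
# Poisson summation for a dilated and translated test function on `𝔸_K`:
# `‖Σ_{ν ∈ K} φ(λ(ν - y))‖ ≤ μ(D)⁻¹ |λ|⁻¹ Σ_{ξ ∈ K} ‖φ̂(ξ λ⁻¹)‖`
(Gelbart, *Automorphic forms on adele groups* (1975), Lemma 9.13 and (9.45): the Poisson step
`Σ_{ν ∈ N_ℚ} f(y⁻¹ μ ν y) = f̂(0, μ, y) + Σ_{ξ ≠ 0} f̂(ξ, μ, y)` for `y = v h_t k` in the cusp, where the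
unipotent variable is dilated by the simple root `e^{2t}` of `h_t`; Tate's Lemma 4.2.4 for the
summation formula)

Topic `NumberTheory/Automorphic`; theorems only. For an additive Haar measure `μ` on `𝔸_K`, a
continuous compactly supported `φ : 𝔸_K → ℂ`, an idele `λ`, an adele `y` and Tate's character
`ψ = adeleAddChar K`:

* `integral_comp_smul_eq_distribHaarChar_inv_smul` — `∫ F(g • x) dμ = Δ(g⁻¹) • ∫ F dμ` (Bochner form
  of `IwasawaHaarGL2.map_constSMul_eq_distribHaarChar_inv_smul`);
* `adeleFourierCoeff_comp_mul_sub` — the Fourier coefficient of `F(u) = φ(λ (u - y))` at `ξ ∈ K` is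
  `ψ(ξ y) · |λ|_𝔸⁻¹ · φ̂(ξ λ⁻¹)`, `φ̂(η) = ∫ φ(v) ψ(η v) dμ(v)` (translation invariance, the module
  `Δ(λ) = |λ|_𝔸` of `IdeleModuleProofs`); `norm_adeleFourierCoeff_comp_mul_sub`;
* `norm_tsum_comp_mul_sub_le` — **main**: if `Σ_{ξ ∈ K} ‖φ̂(ξ λ⁻¹)‖ < ∞` then
  `‖Σ_{ν ∈ K} φ(λ(ν - y))‖ ≤ μ(D)⁻¹ |λ|_𝔸⁻¹ Σ_{ξ ∈ K} ‖φ̂(ξ λ⁻¹)‖`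
  (`AdeleRing.tsum_eq_inv_measure_mul_tsum_adeleFourierCoeff_of_hasCompactSupport`); and
  `tsum_comp_mul_sub_eq` — the identity itself.

Part of the inline (D-0026) decomposition of
`Literature.NumberTheory.Automorphic.jacquetLanglands_transfer_exists` (the `J`-part of the parabolic
term of the `GL₂` trace formula: the Borel sum at `y = k d(a) n(x)` is `Σ_μ Σ_{ν ∈ K} φ_{k,μ}(λ(ν - c_μ x))`
with `λ = a₁/a₂ → 0` in the cusp; with `φ̂(0) = ∫ φ = 0` (supercuspidality) only `ξ ≠ 0` survive).

## References

* S. Gelbart, *Automorphic forms on adele groups*, Ann. of Math. Studies 83 (1975), Lemma 9.13,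
  (9.45) [Gelbart1975].
* J. W. S. Cassels, A. Fröhlich (eds.), *Algebraic Number Theory* (1967), Ch. XV Lemma 4.2.4 and
  Lemma 4.1.2 [CasselsFrohlichANT1967].
-/

noncomputable section

open MeasureTheory Measure NumberField IsDedekindDomain Set Filter Topology
open scoped ENNReal NNReal Pointwise

namespace Literature.NumberTheory.Automorphic

/-! ### Bochner form of the module -/

section Module

variable {G A : Type*} [Group G] [AddCommGroup A] [DistribMulAction G A] [TopologicalSpace A]
  [IsTopologicalAddGroup A] [LocallyCompactSpace A] [ContinuousConstSMul G A]
  [MeasurableSpace A] [BorelSpace A] (μ : Measure A) [μ.IsAddHaarMeasure] [μ.Regular]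
  {E : Type*} [NormedAddCommGroup E] [NormedSpace ℝ E]

/-- **`∫ F(g • x) dμ(x) = Δ(g⁻¹) • ∫ F dμ`** for an additive Haar measure `μ` and the module
`Δ = distribHaarChar A` (Bochner integral; no measurability needed, `x ↦ g • x` is a measurable
embedding). [folklore] -/
theorem integral_comp_smul_eq_distribHaarChar_inv_smul (g : G) (F : A → E) :
    ∫ x, F (g • x) ∂μ = ((distribHaarChar A g⁻¹ : ℝ≥0) : ℝ) • ∫ x, F x ∂μ := by
  have h := (Homeomorph.smul g : A ≃ₜ A).measurableEmbedding.integral_map (μ := μ) F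
  change ∫ x, F ((Homeomorph.smul g : A ≃ₜ A) x) ∂μ = _
  rw [← h]
  have hmap : Measure.map (Homeomorph.smul g : A ≃ₜ A) μ =
      ((distribHaarChar A g⁻¹ : ℝ≥0) : ℝ≥0∞) • μ :=
    map_constSMul_eq_distribHaarChar_inv_smul μ g
  rw [hmap, integral_smul_measure, ENNReal.coe_toReal]

end Module

/-! ### The Fourier coefficient of `u ↦ φ(λ(u - y))` -/

section Fourier

variable (K : Type) [Field K] [NumberField K]

local notation "𝔸K" => AdeleRing (𝓞 K) K
local notation "𝕀K" => (AdeleRing (𝓞 K) K)ˣ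

variable [MeasurableSpace (AdeleRing (𝓞 K) K)] [BorelSpace (AdeleRing (𝓞 K) K)]
  (μ : Measure (AdeleRing (𝓞 K) K)) [μ.IsAddHaarMeasure]

/-- The affine map `u ↦ λ (u - y)` as a homeomorphism of `𝔸_K`. [folklore] -/
def mulSubHomeomorph (lam : 𝕀K) (y : 𝔸K) : 𝔸K ≃ₜ 𝔸K where
  toFun u := (lam : 𝔸K) * (u - y)
  invFun v := ((lam⁻¹ : 𝕀K) : 𝔸K) * v + y
  left_inv u := by simp [← mul_assoc]
  right_inv v := by simp [← mul_assoc]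
  continuous_toFun := by fun_prop
  continuous_invFun := by fun_prop

/-- **`F̂(ξ) = ψ(ξ y) |λ|⁻¹ φ̂(ξ λ⁻¹)`** for `F(u) = φ(λ(u - y))`, `φ̂(η) = ∫ φ(v) ψ(η v) dμ`
(translate `u = w + y`, then dilate `w = λ⁻¹ v`: `d(λ⁻¹ v) = |λ|⁻¹ dv`, Tate's Lemma 4.1.2).
[cite: CasselsFrohlichANT1967, Ch. XV Lemma 4.1.2] -/
theorem adeleFourierCoeff_comp_mul_sub (φ : 𝔸K → ℂ) (lam : 𝕀K) (y : 𝔸K) (ξ : K) :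
    adeleFourierCoeff μ (fun u => φ ((lam : 𝔸K) * (u - y))) ξ =
      (adeleAddChar K (algebraMap K 𝔸K ξ * y) : ℂ) *
        ((((IdeleClassGroup.ideleNorm K lam : ℝ≥0) : ℝ)⁻¹ : ℝ) •
          ∫ v, φ v * (adeleAddChar K (algebraMap K 𝔸K ξ * ((lam⁻¹ : 𝕀K) : 𝔸K) * v) : ℂ) ∂μ) := by
  haveI : LocallyCompactSpace 𝔸K := locallyCompactSpace_adeleRing' K
  haveI : SecondCountableTopology 𝔸K := secondCountableTopology_adeleRing K
  haveI : μ.Regular := by infer_instance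
  rw [adeleFourierCoeff_apply]
  -- translate `u = w + y`
  rw [← integral_add_right_eq_self _ y]
  have h1 : ∀ w : 𝔸K, φ ((lam : 𝔸K) * (w + y - y)) *
      (adeleAddChar K (algebraMap K 𝔸K ξ * (w + y)) : ℂ) =
      (adeleAddChar K (algebraMap K 𝔸K ξ * y) : ℂ) *
        (φ ((lam : 𝔸K) * w) * (adeleAddChar K (algebraMap K 𝔸K ξ * w) : ℂ)) := by
    intro w
    rw [add_sub_cancel_right, mul_add, AddChar.map_add_eq_mul, Circle.coe_mul]
    ring
  simp_rw [h1]
  rw [integral_const_mul]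
  congr 1
  -- dilate `w = λ⁻¹ • v`
  have h2 : ∀ w : 𝔸K, φ ((lam : 𝔸K) * w) * (adeleAddChar K (algebraMap K 𝔸K ξ * w) : ℂ) =
      (fun v : 𝔸K => φ v * (adeleAddChar K (algebraMap K 𝔸K ξ * ((lam⁻¹ : 𝕀K) : 𝔸K) * v) : ℂ))
        (lam • w) := by
    intro w
    simp only [Units.smul_def, smul_eq_mul]
    rw [mul_assoc (algebraMap K 𝔸K ξ), ← mul_assoc ((lam⁻¹ : 𝕀K) : 𝔸K), Units.inv_mul, one_mul]
  simp_rw [h2]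
  have h3 := integral_comp_smul_eq_distribHaarChar_inv_smul μ lam
    (fun v : 𝔸K => φ v * (adeleAddChar K (algebraMap K 𝔸K ξ * ((lam⁻¹ : 𝕀K) : 𝔸K) * v) : ℂ))
  beta_reduce at h3
  rw [h3, map_inv, AdeleRing.distribHaarChar_eq_ideleNorm K lam, NNReal.coe_inv]

/-- `‖F̂(ξ)‖ = |λ|⁻¹ ‖φ̂(ξ λ⁻¹)‖` for `F(u) = φ(λ(u - y))`. [folklore] -/
theorem norm_adeleFourierCoeff_comp_mul_sub (φ : 𝔸K → ℂ) (lam : 𝕀K) (y : 𝔸K) (ξ : K) :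
    ‖adeleFourierCoeff μ (fun u => φ ((lam : 𝔸K) * (u - y))) ξ‖ =
      ((IdeleClassGroup.ideleNorm K lam : ℝ≥0) : ℝ)⁻¹ *
        ‖∫ v, φ v * (adeleAddChar K (algebraMap K 𝔸K ξ * ((lam⁻¹ : 𝕀K) : 𝔸K) * v) : ℂ) ∂μ‖ := by
  rw [adeleFourierCoeff_comp_mul_sub, norm_mul, Circle.norm_coe, one_mul, norm_smul, norm_inv,
    Real.norm_of_nonneg (NNReal.coe_nonneg _)]

/-- **Poisson summation for `u ↦ φ(λ(u - y))`**: for `φ` continuous with compact support and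
`Σ_{ξ ∈ K} ‖φ̂(ξ λ⁻¹)‖ < ∞`,
`Σ_{ν ∈ K} φ(λ(ν - y)) = μ(D)⁻¹ Σ_{ξ ∈ K} ψ(ξ y) |λ|⁻¹ φ̂(ξ λ⁻¹)` (Tate's Lemma 4.2.4 for `F`).
[cite: CasselsFrohlichANT1967, Ch. XV Lemma 4.2.4] -/
theorem tsum_comp_mul_sub_eq {φ : 𝔸K → ℂ} (hφ : Continuous φ) (hφs : HasCompactSupport φ)
    (lam : 𝕀K) (y : 𝔸K)
    (hsum : Summable fun ξ : K =>
      ‖∫ v, φ v * (adeleAddChar K (algebraMap K 𝔸K ξ * ((lam⁻¹ : 𝕀K) : 𝔸K) * v) : ℂ) ∂μ‖) :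
    ∑' ν : K, φ ((lam : 𝔸K) * (algebraMap K 𝔸K ν - y)) =
      (μ (adeleFundamentalDomain K)).toReal⁻¹ * ∑' ξ : K,
        (adeleAddChar K (algebraMap K 𝔸K ξ * y) : ℂ) *
          ((((IdeleClassGroup.ideleNorm K lam : ℝ≥0) : ℝ)⁻¹ : ℝ) •
            ∫ v, φ v * (adeleAddChar K (algebraMap K 𝔸K ξ * ((lam⁻¹ : 𝕀K) : 𝔸K) * v) : ℂ) ∂μ) := by
  have hF : Continuous fun u : 𝔸K => φ ((lam : 𝔸K) * (u - y)) := by fun_prop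
  have hFs : HasCompactSupport fun u : 𝔸K => φ ((lam : 𝔸K) * (u - y)) :=
    hφs.comp_homeomorph (mulSubHomeomorph K lam y)
  have hsum' : Summable fun ξ : K => ‖adeleFourierCoeff μ (fun u => φ ((lam : 𝔸K) * (u - y))) ξ‖ := by
    simp_rw [norm_adeleFourierCoeff_comp_mul_sub]
    exact hsum.mul_left _
  have h := AdeleRing.tsum_eq_inv_measure_mul_tsum_adeleFourierCoeff_of_hasCompactSupport K μ hF hFs hsum'
  simp only [adeleFourierCoeff_comp_mul_sub] at h
  exact h

/-- **`‖Σ_{ν ∈ K} φ(λ(ν - y))‖ ≤ μ(D)⁻¹ |λ|⁻¹ Σ_{ξ ∈ K} ‖φ̂(ξ λ⁻¹)‖`** for `φ` continuous with compact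
support and `Σ_{ξ ∈ K} ‖φ̂(ξ λ⁻¹)‖ < ∞` (Gelbart (1975), Lemma 9.13 and (9.45), the dilation by the
simple root in the cusp). [cite: Gelbart1975, Lemma 9.13] -/
theorem norm_tsum_comp_mul_sub_le {φ : 𝔸K → ℂ} (hφ : Continuous φ) (hφs : HasCompactSupport φ)
    (lam : 𝕀K) (y : 𝔸K)
    (hsum : Summable fun ξ : K =>
      ‖∫ v, φ v * (adeleAddChar K (algebraMap K 𝔸K ξ * ((lam⁻¹ : 𝕀K) : 𝔸K) * v) : ℂ) ∂μ‖) :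
    ‖∑' ν : K, φ ((lam : 𝔸K) * (algebraMap K 𝔸K ν - y))‖ ≤
      (μ (adeleFundamentalDomain K)).toReal⁻¹ * ((IdeleClassGroup.ideleNorm K lam : ℝ≥0) : ℝ)⁻¹ *
        ∑' ξ : K, ‖∫ v, φ v * (adeleAddChar K (algebraMap K 𝔸K ξ * ((lam⁻¹ : 𝕀K) : 𝔸K) * v) : ℂ) ∂μ‖ := by
  have hsumF : Summable fun ξ : K => ‖(adeleAddChar K (algebraMap K 𝔸K ξ * y) : ℂ) *
      ((((IdeleClassGroup.ideleNorm K lam : ℝ≥0) : ℝ)⁻¹ : ℝ) •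
        ∫ v, φ v * (adeleAddChar K (algebraMap K 𝔸K ξ * ((lam⁻¹ : 𝕀K) : 𝔸K) * v) : ℂ) ∂μ)‖ := by
    have : ∀ ξ : K, ‖(adeleAddChar K (algebraMap K 𝔸K ξ * y) : ℂ) *
        ((((IdeleClassGroup.ideleNorm K lam : ℝ≥0) : ℝ)⁻¹ : ℝ) •
          ∫ v, φ v * (adeleAddChar K (algebraMap K 𝔸K ξ * ((lam⁻¹ : 𝕀K) : 𝔸K) * v) : ℂ) ∂μ)‖ =
        ((IdeleClassGroup.ideleNorm K lam : ℝ≥0) : ℝ)⁻¹ *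
          ‖∫ v, φ v * (adeleAddChar K (algebraMap K 𝔸K ξ * ((lam⁻¹ : 𝕀K) : 𝔸K) * v) : ℂ) ∂μ‖ := by
      intro ξ
      rw [norm_mul, Circle.norm_coe, one_mul, norm_smul, norm_inv, Real.norm_of_nonneg (NNReal.coe_nonneg _)]
    simp_rw [this]
    exact hsum.mul_left _
  rw [tsum_comp_mul_sub_eq K μ hφ hφs lam y hsum, norm_mul, Complex.norm_real, norm_inv,
    Real.norm_of_nonneg ENNReal.toReal_nonneg, mul_assoc]
  gcongr
  refine (norm_tsum_le_tsum_norm hsumF).trans (le_of_eq ?_)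
  rw [← tsum_mul_left]
  refine tsum_congr fun ξ => ?_
  rw [norm_mul, Circle.norm_coe, one_mul, norm_smul, norm_inv, Real.norm_of_nonneg (NNReal.coe_nonneg _)]

end Fourier

end Literature.NumberTheory.Automorphic
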